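import Literature.NumberTheory.Automorphic.Zelevinsky1980.MaximalParabolicOpenCellRadical
import Literature.NumberTheory.Automorphic.OpenCellStandardSectionDecomposition
import Literature.NumberTheory.Automorphic.GLnIwahoriBorelFactorization
import HarnessLib

/-!
# The open-cell exponent of `Ind_{Q_{N-1,1}}^{GL_N}`: `d(ϖ)` acts on the `U_c`-coinvariants of `I_open` by `q_F · σ'(d₀(ϖ))`

Topic `NumberTheory/Automorphic/Zelevinsky1980`; theorems only (no definition, no named fact). Let `F` be
a non-archimedean local field, `P = Q_{N-1,1} = standardParabolicGL F (lastBlockLabel N)` (`N = n + 2`),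
`σ'` a smooth representation of `P`, `I = Ind_P^{GL_N} σ'` (`Representation.smoothIndRep`), `I_open ≤ I`
the functions vanishing off the open cell `P w₀ U_N` (`vanishingOn … (cellLT … w₀)`), `U_c` the unipotent
radical of `P`, `d(t) = diag(1, …, 1, t)` and `d₀(t) = diag(t, 1, …, 1) = w₀ d(t) w₀⁻¹`.

* `exists_transversal_conj_box` — for a uniformizer `ϖ` and `m ≥ 1`, the congruence box
  `K'_m = N' ∩ K_{ϖ^m}` satisfies `K'_m ≤ d(ϖ) K'_m d(ϖ)⁻¹` with the `q_F = #𝓀_F` elementary matrices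
  `1 + ϖ^{m-1} s(κ) E_{0,last} ∈ U_c ∩ N'` as a left transversal;
* `mk_smoothIndRep_cellSection_transversal` — the class computation on one standard section;
* `mk_smoothIndRep_diag_eq_smul_of_mem_vanishingOn` — **the open-cell exponent**: if `d₀(ϖ)` acts on
  `W` by the scalar `s`, then `[d(ϖ) · f] = (q_F s) • [f]` in the `U_c`-coinvariants of `I` for every
  `f ∈ I_open`.

This is the open orbit of Bernstein–Zelevinsky's geometric lemma (1977, Thm. 5.2) for the pair
`(Q_{N-1,1}, Q_{N-1,1})` — `(I_open)_{U_c} ≅ i_{M ∩ w₀ P w₀⁻¹}^{M}(w₀ ∘ σ')` with its modulus twist —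
in the weak form needed for the irreducibility of `(ν₀ ∘ det) × χ′` (Zelevinsky 1980, Thm. 4.2, the
case of unitary characters; file `ParabolicIndGLDetCharIrreducible`): only the action of the central
element `d(ϖ)` of the Levi is computed, and no Haar measure is used (the factor `q_F` is a coset count).

## References

* I. N. Bernstein, A. V. Zelevinsky, *Induced representations of reductive `p`-adic groups I*,
  Ann. Sci. ÉNS 10 (1977), Thm. 5.2. [BernsteinZelevinskyASENS1977]
* A. V. Zelevinsky, *Induced representations of reductive `p`-adic groups II*, Ann. Sci. ÉNS 13
  (1980), §1, Thm. 4.2. [Zelevinsky1980]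
-/

noncomputable section

open Matrix Literature.LinearAlgebra.Matrix.DiagonalTorus

namespace Literature.NumberTheory.Automorphic.Zelevinsky1980

open ValuativeRel Valued

variable {F : Type*} [Field F] [ValuativeRel F] [TopologicalSpace F] [IsNonarchimedeanLocalField F]
  {n : ℕ}

omit [TopologicalSpace F] [IsNonarchimedeanLocalField F] in
/-- For a uniformizer `ϖ`: `v y < 1 ↔ v y ≤ v ϖ`. [cite: BernsteinZelevinskyASENS1977, Thm. 5.2 and §7.1] -/
theorem valuation_lt_one_iff_le_valuation {ϖ : F} (hϖ : IsUniformizingElement ϖ) (y : F) :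
    valuation F y < 1 ↔ valuation F y ≤ valuation F ϖ := by
  constructor
  · intro hy
    have hy' : y ∈ 𝒪[F] := (Valuation.mem_integer_iff _ _).2 hy.le
    obtain ⟨z, hz, rfl⟩ := hϖ.exists_eq_mul hy' hy
    rw [map_mul]
    exact mul_le_of_le_one_right' ((Valuation.mem_integer_iff _ _).1 hz)
  · exact fun h => h.trans_lt hϖ.valuation_lt_one

omit [TopologicalSpace F] [IsNonarchimedeanLocalField F] in
/-- **The congruence boxes of `N'`.** For `γ < 1`, an element `x ∈ N'` lies in the principal
congruence subgroup `K_γ` iff its first-row entries `x_{0j}`, `j ≠ 0`, have valuation `≤ γ`. [cite: BernsteinZelevinskyASENS1977, Thm. 5.2 and §7.1] -/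
theorem mem_congruenceGL_iff_of_mem_oppositeCellRadical {γ : ValueGroupWithZero F} (hγ : γ < 1)
    {x : GL (Fin (n + 2)) F} (hx : x ∈ oppositeCellRadical (K := F) (lastBlockLabel (n + 2))) :
    x ∈ congruenceGL (n + 2) γ ↔
      ∀ j : Fin (n + 2), j ≠ 0 → valuation F ((x : Matrix (Fin (n + 2)) (Fin (n + 2)) F) 0 j) ≤ γ := by
  constructor
  · intro h j hj
    have := valuation_apply_sub_one_le_of_mem_congruenceGL h 0 j
    rwa [if_neg (Ne.symm hj), sub_zero] at this
  · intro h
    refine mem_congruenceGL_of_valBound_sub_one hγ fun i j => ?_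
    rw [Matrix.sub_apply]
    by_cases hij : (i : ℕ) = 0 ∧ (j : ℕ) ≠ 0
    · have hi : i = 0 := Fin.ext hij.1
      have hj : j ≠ 0 := fun h => hij.2 (by rw [h]; rfl)
      subst hi
      rw [Matrix.one_apply_ne (Ne.symm hj), sub_zero]
      exact h j hj
    · rw [(mem_oppositeCellRadical_lastBlockLabel_iff x).1 hx i j hij, sub_self, map_zero]
      exact zero_le

/-- The congruence box `N' ∩ K_γ` is open in `N'`. [cite: BernsteinZelevinskyASENS1977, Thm. 5.2 and §7.1] -/
theorem isOpen_comap_congruenceGL {γ : ValueGroupWithZero F} (hγ : γ ≠ 0) {N : ℕ} :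
    IsOpen (((congruenceGL N γ).comap (oppositeCellRadical (K := F) (lastBlockLabel N)).subtype :
      Subgroup ↥(oppositeCellRadical (K := F) (lastBlockLabel N))) :
        Set ↥(oppositeCellRadical (K := F) (lastBlockLabel N))) :=
  (isOpen_congruenceGL hγ).preimage continuous_subtype_val

/-- The congruence box `N' ∩ K_γ` is compact in `N'`. [cite: BernsteinZelevinskyASENS1977, Thm. 5.2 and §7.1] -/
theorem isCompact_comap_congruenceGL (γ : ValueGroupWithZero F) {N : ℕ} :
    IsCompact (((congruenceGL N γ).comap (oppositeCellRadical (K := F) (lastBlockLabel N)).subtype :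
      Subgroup ↥(oppositeCellRadical (K := F) (lastBlockLabel N))) :
        Set ↥(oppositeCellRadical (K := F) (lastBlockLabel N))) :=
  (isClosed_oppositeCellRadical (c := lastBlockLabel N)).isClosedEmbedding_subtypeVal.isCompact_preimage
    (isCompact_congruenceGL γ)

/-! #### The congruence boxes `K'_m = N' ∩ K_{ϖ^m}` and the transversal of `d(ϖ) K'_m d(ϖ)⁻¹ / K'_m` -/

/-- **The `q_F` cosets.** For a uniformizer `ϖ` and `m ≥ 1`, the conjugate `d(ϖ) K'_m d(ϖ)⁻¹` of the
box `K'_m = N' ∩ K_{ϖ^m}` contains `K'_m`, and the `q_F = #𝓀_F` elementary matrices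
`1 + ϖ^{m-1} s(κ) E_{0,last}` (`s` a section of the residue map) form a left transversal; they lie in
`U_c ∩ N'`. [cite: BernsteinZelevinskyASENS1977, Thm. 5.2 and §7.1] -/
theorem exists_transversal_conj_box {ϖ : F} (hϖ : IsUniformizingElement ϖ) {m : ℕ} (hm1 : 1 ≤ m) :
    ∃ R : Finset ↥(oppositeCellRadical (K := F) (lastBlockLabel (n + 2))),
      R.card = GaloisRepresentations.IsNonarchimedeanLocalField.residueFieldCard F ∧
      (∀ ρ ∈ R, (ρ : GL (Fin (n + 2)) F) ∈ unipotentRadicalGL F (lastBlockLabel (n + 2)) ∧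
        ∀ j : Fin (n + 2), j ≠ 0 → j ≠ Fin.last (n + 1) → ((ρ : GL (Fin (n + 2)) F) : Matrix (Fin (n + 2)) (Fin (n + 2)) F) 0 j = 0) ∧
      (congruenceGL (n + 2) (valuation F ϖ ^ m)).comap (oppositeCellRadical (K := F) (lastBlockLabel (n + 2))).subtype ≤
        conjSubgroup (diagGL_mem_standardParabolicGL (⇑OrderDual.toDual ∘ revLabel (lastBlockLabel (n + 2)))
          (Function.update 1 (Fin.last (n + 1)) (Units.mk0 ϖ hϖ.ne_zero)))
          ((congruenceGL (n + 2) (valuation F ϖ ^ m)).comap (oppositeCellRadical (K := F) (lastBlockLabel (n + 2))).subtype) ∧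
      IsLeftTransversal
        (conjSubgroup (diagGL_mem_standardParabolicGL (⇑OrderDual.toDual ∘ revLabel (lastBlockLabel (n + 2)))
          (Function.update 1 (Fin.last (n + 1)) (Units.mk0 ϖ hϖ.ne_zero)))
          ((congruenceGL (n + 2) (valuation F ϖ ^ m)).comap (oppositeCellRadical (K := F) (lastBlockLabel (n + 2))).subtype))
        ((congruenceGL (n + 2) (valuation F ϖ ^ m)).comap (oppositeCellRadical (K := F) (lastBlockLabel (n + 2))).subtype) R := by
  classical
  set tϖ : Fˣ := Units.mk0 ϖ hϖ.ne_zero with htϖ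
  set a : GL (Fin (n + 2)) F := diagGL (Fin (n + 2)) (Function.update 1 (Fin.last (n + 1)) tϖ) with ha_def
  have haP' : a ∈ standardParabolicGL F (⇑OrderDual.toDual ∘ revLabel (lastBlockLabel (n + 2))) :=
    diagGL_mem_standardParabolicGL _ _
  have hlast0 : (Fin.last (n + 1) : Fin (n + 2)) ≠ 0 := by simp [Fin.ext_iff]
  set γ : ValueGroupWithZero F := valuation F ϖ ^ m with hγ_def
  have hγ1 : γ < 1 := hϖ.valuation_pow_lt_one hm1
  set K' : Subgroup ↥(oppositeCellRadical (K := F) (lastBlockLabel (n + 2))) :=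
    (congruenceGL (n + 2) γ).comap (oppositeCellRadical (K := F) (lastBlockLabel (n + 2))).subtype with hK'_def
  have hK'mem : ∀ x : ↥(oppositeCellRadical (K := F) (lastBlockLabel (n + 2))), x ∈ K' ↔
      ∀ j : Fin (n + 2), j ≠ 0 → valuation F (((x : GL (Fin (n + 2)) F) : Matrix (Fin (n + 2)) (Fin (n + 2)) F) 0 j) ≤ γ :=
    fun x => by
      rw [hK'_def, Subgroup.mem_comap, Subgroup.coe_subtype]
      exact mem_congruenceGL_iff_of_mem_oppositeCellRadical hγ1 x.2
  have hconj_apply : ∀ (x : GL (Fin (n + 2)) F) (j : Fin (n + 2)),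
      ((a⁻¹ * x * a : GL (Fin (n + 2)) F) : Matrix (Fin (n + 2)) (Fin (n + 2)) F) 0 j = (x : Matrix (Fin (n + 2)) (Fin (n + 2)) F) 0 j * if j = Fin.last (n + 1) then ϖ else 1 := by
    intro x j
    rw [ha_def, diag_inv_mul_mul_apply_zero, htϖ, Units.val_mk0]
  -- `K' ≤ a K' a⁻¹`
  have hKs : K' ≤ conjSubgroup haP' K' := by
    intro x hx
    rw [mem_conjSubgroup_iff, hK'mem]
    intro j hj
    rw [coe_radicalConj_symm, hconj_apply]
    split_ifs with hjl
    · rw [map_mul]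
      exact mul_le_of_le_of_le_one ((hK'mem x).1 hx j hj) hϖ.valuation_le_one
    · rw [mul_one]; exact (hK'mem x).1 hx j hj
  -- the elementary matrices
  obtain ⟨sec, hsec⟩ : ∃ sec : 𝓀[F] → 𝒪[F], ∀ κ, IsLocalRing.residue _ (sec κ) = κ :=
    ⟨Function.surjInv IsLocalRing.residue_surjective, Function.surjInv_eq IsLocalRing.residue_surjective⟩
  have he := fun κ : 𝓀[F] => exists_transvection_mem (F := F) (n := n) (ϖ ^ (m - 1) * (sec κ : F))
  choose e heN heU heval using he
  letI : Fintype 𝓀[F] := Fintype.ofFinite _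
  have he_apply : ∀ κ (j : Fin (n + 2)), j ≠ 0 → ((e κ : GL (Fin (n + 2)) F) : Matrix (Fin (n + 2)) (Fin (n + 2)) F) 0 j =
      if j = Fin.last (n + 1) then ϖ ^ (m - 1) * (sec κ : F) else 0 := by
    intro κ j hj
    rw [heval, Matrix.transvection, Matrix.add_apply, Matrix.one_apply_ne (Ne.symm hj), zero_add]
    split_ifs with hjl
    · rw [hjl, Matrix.single_apply_same]
    · rw [Matrix.single_apply_of_ne]
      rintro ⟨-, h⟩
      exact hjl h.symm
  set eN : 𝓀[F] → ↥(oppositeCellRadical (K := F) (lastBlockLabel (n + 2))) := fun κ => ⟨e κ, heN κ⟩ with heN_def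
  have heN_inj : Function.Injective eN := by
    intro κ κ' h
    have h1 := congrArg (fun x : ↥(oppositeCellRadical (K := F) (lastBlockLabel (n + 2))) => ((x : GL (Fin (n + 2)) F) : Matrix (Fin (n + 2)) (Fin (n + 2)) F) 0 (Fin.last (n + 1))) h
    simp only [heN_def] at h1
    rw [he_apply κ _ hlast0, he_apply κ' _ hlast0, if_pos rfl, if_pos rfl] at h1
    have h2 : (sec κ : F) = sec κ' := mul_left_cancel₀ (pow_ne_zero _ hϖ.ne_zero) h1
    rw [← hsec κ, ← hsec κ', Subtype.ext h2]
  refine ⟨Finset.univ.image eN, ?_, ?_, hKs, ?_⟩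
  · rw [Finset.card_image_of_injective _ heN_inj, Finset.card_univ,
      GaloisRepresentations.IsNonarchimedeanLocalField.residueFieldCard, Nat.card_eq_fintype_card]
  · intro ρ hρ
    obtain ⟨κ, -, rfl⟩ := Finset.mem_image.1 hρ
    refine ⟨heU κ, fun j hj hjl => ?_⟩
    change ((e κ : GL (Fin (n + 2)) F) : Matrix (Fin (n + 2)) (Fin (n + 2)) F) 0 j = 0
    rw [he_apply κ j hj, if_neg hjl]
  -- the valuation bookkeeping for the last coordinate
  have hvϖ0 : valuation F ϖ ≠ 0 := (Valuation.ne_zero_iff _).mpr hϖ.ne_zero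
  have hvϖm0 : valuation F ϖ ^ (m - 1) ≠ 0 := pow_ne_zero _ hvϖ0
  have hγsplit : γ = valuation F ϖ ^ (m - 1) * valuation F ϖ := by
    rw [hγ_def, ← pow_succ, Nat.sub_add_cancel hm1]
  have hcancel : ∀ {c u v : ValueGroupWithZero F}, c ≠ 0 → (c * u ≤ c * v ↔ u ≤ v) := by
    intro c u v hc0
    refine ⟨fun h => ?_, fun h => mul_le_mul_right h c⟩
    have := mul_le_mul_right h c⁻¹
    rwa [inv_mul_cancel_left₀ hc0, inv_mul_cancel_left₀ hc0] at this
  have hkey : ∀ (y : F), valuation F (y * ϖ) ≤ γ →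
      ∃ z : 𝒪[F], y = ϖ ^ (m - 1) * (z : F) ∧
        ∀ κ, valuation F (y - ϖ ^ (m - 1) * (sec κ : F)) ≤ γ ↔ IsLocalRing.residue _ z = κ := by
    intro y hy
    have hy1 : valuation F y ≤ valuation F ϖ ^ (m - 1) := by
      rw [map_mul, hγsplit, mul_comm (valuation F y), mul_comm (valuation F ϖ ^ (m - 1))] at hy
      exact (hcancel hvϖ0).1 hy
    have hy' : valuation F ((ϖ ^ (m - 1))⁻¹ * y) ≤ 1 := by
      rw [map_mul, map_inv₀, map_pow]
      have := mul_le_mul_right hy1 (valuation F ϖ ^ (m - 1))⁻¹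
      rwa [inv_mul_cancel₀ hvϖm0] at this
    refine ⟨⟨(ϖ ^ (m - 1))⁻¹ * y, (Valuation.mem_integer_iff _ _).2 hy'⟩, ?_, fun κ => ?_⟩
    · simp only
      rw [mul_inv_cancel_left₀ (pow_ne_zero _ hϖ.ne_zero)]
    · rw [← hsec κ, DeltaCharBorel.residue_eq_residue_iff, valuation_lt_one_iff_le_valuation hϖ, hsec κ]
      simp only
      have e1 : y - ϖ ^ (m - 1) * (sec κ : F) = ϖ ^ (m - 1) * ((ϖ ^ (m - 1))⁻¹ * y - (sec κ : F)) := by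
        rw [mul_sub, mul_inv_cancel_left₀ (pow_ne_zero _ hϖ.ne_zero)]
      rw [e1, map_mul, map_pow, hγsplit]
      exact hcancel hvϖm0
  -- the transversal property
  refine ⟨fun r hr => ?_, fun x hx => ?_⟩
  · obtain ⟨κ, -, rfl⟩ := Finset.mem_image.1 hr
    rw [mem_conjSubgroup_iff, hK'mem]
    intro j hj
    rw [coe_radicalConj_symm, hconj_apply]
    change valuation F (((e κ : GL (Fin (n + 2)) F) : Matrix (Fin (n + 2)) (Fin (n + 2)) F) 0 j * _) ≤ γ
    rw [he_apply κ j hj]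
    split_ifs with hjl
    · rw [mul_assoc, mul_comm (sec κ : F), ← mul_assoc, ← pow_succ, Nat.sub_add_cancel hm1, map_mul, map_pow,
        hγ_def]
      exact mul_le_of_le_one_right' ((Valuation.mem_integer_iff _ _).1 (sec κ).2)
    · rw [zero_mul, map_zero]; exact zero_le
  · have hx' := (hK'mem _).1 ((mem_conjSubgroup_iff haP' K' x).1 hx)
    have hxj : ∀ j : Fin (n + 2), j ≠ 0 → j ≠ Fin.last (n + 1) →
        valuation F (((x : GL (Fin (n + 2)) F) : Matrix (Fin (n + 2)) (Fin (n + 2)) F) 0 j) ≤ γ := by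
      intro j hj hjl
      have := hx' j hj
      rwa [coe_radicalConj_symm, hconj_apply, if_neg hjl, mul_one] at this
    have hxl : valuation F (((x : GL (Fin (n + 2)) F) : Matrix (Fin (n + 2)) (Fin (n + 2)) F) 0 (Fin.last (n + 1)) * ϖ) ≤ γ := by
      have := hx' _ hlast0
      rwa [coe_radicalConj_symm, hconj_apply, if_pos rfl] at this
    obtain ⟨z, hz, hzκ⟩ := hkey _ hxl
    have hcond : ∀ κ, (eN κ)⁻¹ * x ∈ K' ↔ IsLocalRing.residue _ z = κ := by
      intro κ
      rw [← hzκ κ, hK'mem]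
      have hentry : ∀ j : Fin (n + 2), j ≠ 0 →
          ((((eN κ)⁻¹ * x : ↥(oppositeCellRadical (K := F) (lastBlockLabel (n + 2)))) : GL (Fin (n + 2)) F) : Matrix (Fin (n + 2)) (Fin (n + 2)) F) 0 j =
            ((x : GL (Fin (n + 2)) F) : Matrix (Fin (n + 2)) (Fin (n + 2)) F) 0 j - if j = Fin.last (n + 1) then ϖ ^ (m - 1) * (sec κ : F) else 0 := by
        intro j hj
        rw [Subgroup.coe_mul, InvMemClass.coe_inv,
          mul_apply_zero_of_mem_oppositeCellRadical (Subgroup.inv_mem _ (heN κ)) x.2 hj,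
          inv_apply_zero_of_mem_oppositeCellRadical (heN κ) hj, he_apply κ j hj]
        ring
      constructor
      · intro h
        have := h _ hlast0
        rwa [hentry _ hlast0, if_pos rfl] at this
      · intro h j hj
        rw [hentry j hj]
        split_ifs with hjl
        · rw [hjl]; exact h
        · rw [sub_zero]; exact hxj j hj hjl
    refine ⟨eN (IsLocalRing.residue _ z), ⟨Finset.mem_image_of_mem _ (Finset.mem_univ _), (hcond _).2 rfl⟩, ?_⟩
    rintro r ⟨hr, hrx⟩
    obtain ⟨κ, -, rfl⟩ := Finset.mem_image.1 hr
    rw [(hcond κ).1 hrx]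

variable {W : Type*} [AddCommGroup W] [Module ℂ W]
  (σ' : Representation ℂ ↥(standardParabolicGL F (lastBlockLabel (n + 2))) W)

/-- In the `U_c`-coinvariants, right translation by `u ∈ U_c` does not change the class. [cite: BernsteinZelevinskyASENS1977, Thm. 5.2 and §7.1] -/
theorem mk_smoothIndRep_eq_of_mem_unipotentRadicalGL {u : GL (Fin (n + 2)) F} (hu : u ∈ unipotentRadicalGL F (lastBlockLabel (n + 2)))
    (y : Representation.SmoothInd (standardParabolicGL F (lastBlockLabel (n + 2))) σ') :
    Representation.Coinvariants.mk (Representation.restrictUnipotentGL F (lastBlockLabel (n + 2)) (Representation.smoothIndRep (standardParabolicGL F (lastBlockLabel (n + 2))) σ')) (Representation.smoothIndRep (standardParabolicGL F (lastBlockLabel (n + 2))) σ' u y) = Representation.Coinvariants.mk (Representation.restrictUnipotentGL F (lastBlockLabel (n + 2)) (Representation.smoothIndRep (standardParabolicGL F (lastBlockLabel (n + 2))) σ')) y := by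
  obtain ⟨p, hp, hpu⟩ := Subgroup.mem_map.1 hu
  have := Representation.Coinvariants.mk_self_apply
    (Representation.restrictUnipotentGL F (lastBlockLabel (n + 2)) (Representation.smoothIndRep (standardParabolicGL F (lastBlockLabel (n + 2))) σ')) ⟨p, hp⟩ y
  rw [← hpu]
  exact this

set_option maxHeartbeats 400000 in
/-- **The open-cell exponent on a standard section.** Let `a ∈ P'` with `w₀ a w₀⁻¹ ∈ P_c` acting on
`w ∈ W` by the scalar `s`, `K' ≤ N'` compact open with `K' ≤ a K' a⁻¹`, and `R` a left transversal of
`a K' a⁻¹ / K'` such that `a r⁻¹ a⁻¹ ρ r ∈ U_c` for `ρ ∈ R` (for `a = d(t)` and `r ∈ N'` this is the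
commutator trick). Then `[a · r⁻¹ · Φ_{K',w}] = (#R · s) • [r⁻¹ · Φ_{K',w}]` in the `U_c`-coinvariants. [cite: BernsteinZelevinskyASENS1977, Thm. 5.2 and §7.1] -/
theorem mk_smoothIndRep_cellSection_transversal (hσ' : σ'.IsSmooth) {a : GL (Fin (n + 2)) F}
    (haP' : a ∈ standardParabolicGL F (⇑OrderDual.toDual ∘ revLabel (lastBlockLabel (n + 2))))
    (haP : permGL Fin.revPerm * a * (permGL Fin.revPerm)⁻¹ ∈ standardParabolicGL F (lastBlockLabel (n + 2)))
    (K' : Subgroup ↥(oppositeCellRadical (K := F) (lastBlockLabel (n + 2)))) (hK'o : IsOpen (K' : Set ↥(oppositeCellRadical (K := F) (lastBlockLabel (n + 2))))) (hK'c : IsCompact (K' : Set ↥(oppositeCellRadical (K := F) (lastBlockLabel (n + 2)))))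
    (R : Finset ↥(oppositeCellRadical (K := F) (lastBlockLabel (n + 2)))) (r : GL (Fin (n + 2)) F)
    (hRU : ∀ ρ ∈ R, a * r⁻¹ * a⁻¹ * (ρ : GL (Fin (n + 2)) F) * r ∈ unipotentRadicalGL F (lastBlockLabel (n + 2)))
    (hKs : K' ≤ conjSubgroup haP' K') (hR : IsLeftTransversal (conjSubgroup haP' K') K' R)
    {s : ℂ} {w : W} (hs : σ' ⟨permGL Fin.revPerm * a * (permGL Fin.revPerm)⁻¹, haP⟩ w = s • w) :
    Representation.Coinvariants.mk (Representation.restrictUnipotentGL F (lastBlockLabel (n + 2)) (Representation.smoothIndRep (standardParabolicGL F (lastBlockLabel (n + 2))) σ')) (Representation.smoothIndRep (standardParabolicGL F (lastBlockLabel (n + 2))) σ' a (Representation.smoothIndRep (standardParabolicGL F (lastBlockLabel (n + 2))) σ' r⁻¹ (cellSection σ' (monotone_lastBlockLabel (n + 2)) hσ' K' hK'o hK'c w))) =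
      ((R.card : ℂ) * s) • Representation.Coinvariants.mk (Representation.restrictUnipotentGL F (lastBlockLabel (n + 2)) (Representation.smoothIndRep (standardParabolicGL F (lastBlockLabel (n + 2))) σ')) (Representation.smoothIndRep (standardParabolicGL F (lastBlockLabel (n + 2))) σ' r⁻¹ (cellSection σ' (monotone_lastBlockLabel (n + 2)) hσ' K' hK'o hK'c w)) := by
  classical
  have hc : Monotone (lastBlockLabel (n + 2)) := monotone_lastBlockLabel (n + 2)
  -- `a r⁻¹ = (a r⁻¹ a⁻¹) a`
  have e1 : Representation.smoothIndRep (standardParabolicGL F (lastBlockLabel (n + 2))) σ' a (Representation.smoothIndRep (standardParabolicGL F (lastBlockLabel (n + 2))) σ' r⁻¹ (cellSection σ' hc hσ' K' hK'o hK'c w)) =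
      Representation.smoothIndRep (standardParabolicGL F (lastBlockLabel (n + 2))) σ' (a * r⁻¹ * a⁻¹) (Representation.smoothIndRep (standardParabolicGL F (lastBlockLabel (n + 2))) σ' a (cellSection σ' hc hσ' K' hK'o hK'c w)) := by
    rw [← Module.End.mul_apply, ← map_mul, ← Module.End.mul_apply, ← map_mul, inv_mul_cancel_right]
  -- `a · Φ_{K',w} = s • Φ_{aK'a⁻¹, w} = s • ∑_ρ ρ · Φ_{K', w}`
  have e2a := smoothIndRep_cellSection_of_conj_mem σ' hc hσ' K' hK'o hK'c w haP' haP
  have e2c : cellSection σ' hc hσ' (conjSubgroup haP' K') (isOpen_conjSubgroup _ hK'o) (isCompact_conjSubgroup _ hK'c)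
      (s • w) = s • cellSection σ' hc hσ' (conjSubgroup haP' K') (isOpen_conjSubgroup _ hK'o)
        (isCompact_conjSubgroup _ hK'c) w := by
    have := (cellSectionₗ σ' hc hσ' (conjSubgroup haP' K') (isOpen_conjSubgroup _ hK'o)
      (isCompact_conjSubgroup _ hK'c)).map_smul s w
    simpa only [cellSectionₗ_apply] using this
  have e2d := cellSection_eq_sum_smoothIndRep hc hσ' hKs (isOpen_conjSubgroup _ hK'o) (isCompact_conjSubgroup _ hK'c)
    hK'o hK'c hR w
  rw [e1, e2a, hs, e2c, e2d, LinearMap.map_smul, LinearMap.map_smul]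
  have e5 : Representation.smoothIndRep (standardParabolicGL F (lastBlockLabel (n + 2))) σ' (a * r⁻¹ * a⁻¹) (∑ ρ ∈ R, Representation.smoothIndRep (standardParabolicGL F (lastBlockLabel (n + 2))) σ' ((ρ : ↥(oppositeCellRadical (K := F) (lastBlockLabel (n + 2)))) : GL (Fin (n + 2)) F) (cellSection σ' hc hσ' K' hK'o hK'c w)) =
      ∑ ρ ∈ R, Representation.smoothIndRep (standardParabolicGL F (lastBlockLabel (n + 2))) σ' (a * r⁻¹ * a⁻¹) (Representation.smoothIndRep (standardParabolicGL F (lastBlockLabel (n + 2))) σ' ((ρ : ↥(oppositeCellRadical (K := F) (lastBlockLabel (n + 2)))) : GL (Fin (n + 2)) F) (cellSection σ' hc hσ' K' hK'o hK'c w)) :=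
    map_sum _ _ _
  rw [e5]
  have e6 : Representation.Coinvariants.mk (Representation.restrictUnipotentGL F (lastBlockLabel (n + 2)) (Representation.smoothIndRep (standardParabolicGL F (lastBlockLabel (n + 2))) σ')) (∑ ρ ∈ R, Representation.smoothIndRep (standardParabolicGL F (lastBlockLabel (n + 2))) σ' (a * r⁻¹ * a⁻¹) (Representation.smoothIndRep (standardParabolicGL F (lastBlockLabel (n + 2))) σ' ((ρ : ↥(oppositeCellRadical (K := F) (lastBlockLabel (n + 2)))) : GL (Fin (n + 2)) F) (cellSection σ' hc hσ' K' hK'o hK'c w))) =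
      ∑ ρ ∈ R, Representation.Coinvariants.mk (Representation.restrictUnipotentGL F (lastBlockLabel (n + 2)) (Representation.smoothIndRep (standardParabolicGL F (lastBlockLabel (n + 2))) σ')) (Representation.smoothIndRep (standardParabolicGL F (lastBlockLabel (n + 2))) σ' (a * r⁻¹ * a⁻¹) (Representation.smoothIndRep (standardParabolicGL F (lastBlockLabel (n + 2))) σ' ((ρ : ↥(oppositeCellRadical (K := F) (lastBlockLabel (n + 2)))) : GL (Fin (n + 2)) F) (cellSection σ' hc hσ' K' hK'o hK'c w))) :=
    map_sum _ _ _
  rw [e6]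
  -- each term has the class of `r⁻¹ · Φ_{K',w}`
  have e3 : ∀ ρ ∈ R, Representation.Coinvariants.mk (Representation.restrictUnipotentGL F (lastBlockLabel (n + 2)) (Representation.smoothIndRep (standardParabolicGL F (lastBlockLabel (n + 2))) σ')) (Representation.smoothIndRep (standardParabolicGL F (lastBlockLabel (n + 2))) σ' (a * r⁻¹ * a⁻¹) (Representation.smoothIndRep (standardParabolicGL F (lastBlockLabel (n + 2))) σ' ((ρ : ↥(oppositeCellRadical (K := F) (lastBlockLabel (n + 2)))) : GL (Fin (n + 2)) F) (cellSection σ' hc hσ' K' hK'o hK'c w))) =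
      Representation.Coinvariants.mk (Representation.restrictUnipotentGL F (lastBlockLabel (n + 2)) (Representation.smoothIndRep (standardParabolicGL F (lastBlockLabel (n + 2))) σ')) (Representation.smoothIndRep (standardParabolicGL F (lastBlockLabel (n + 2))) σ' r⁻¹ (cellSection σ' hc hσ' K' hK'o hK'c w)) := by
    intro ρ hρ
    have e4 : a * r⁻¹ * a⁻¹ * (ρ : GL (Fin (n + 2)) F) = (a * r⁻¹ * a⁻¹ * (ρ : GL (Fin (n + 2)) F) * r) * r⁻¹ := by
      rw [mul_inv_cancel_right]
    rw [← Module.End.mul_apply, ← map_mul, e4, map_mul, Module.End.mul_apply]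
    exact mk_smoothIndRep_eq_of_mem_unipotentRadicalGL σ' (hRU ρ hρ) _
  rw [Finset.sum_congr rfl e3, Finset.sum_const, ← Nat.cast_smul_eq_nsmul ℂ, smul_smul, mul_comm s]

/-- **The open-cell exponent.** Let `σ'` be a smooth representation of `P = Q_{N-1,1}` (`N = n + 2`) on
which `d₀(ϖ) = diag(ϖ, 1, …, 1) = w₀ d(ϖ) w₀⁻¹` acts by the scalar `s`, `ϖ` a uniformizer and
`d(ϖ) = diag(1, …, 1, ϖ)`. Then for every `f` in the open-cell part `I_open` of `Ind_P^{GL_N} σ'`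
(functions vanishing off `P w₀ U_N`), in the `U_c`-coinvariants (`U_c` the unipotent radical of `P`):
`[d(ϖ) · f] = q_F s · [f]`, `q_F = #𝓀_F`. (The open orbit of the geometric lemma,
Bernstein–Zelevinsky 1977, Thm. 5.2, for the pair `(Q_{N-1,1}, Q_{N-1,1})`: conjugation by `d(ϖ)`
expands the last coordinate of `N' ≅ F^{N-1}` by `ϖ⁻¹`, and the `q_F` cosets are permuted by
`U_c ∩ N'`.) [cite: BernsteinZelevinskyASENS1977, Thm. 5.2] -/
theorem mk_smoothIndRep_diag_eq_smul_of_mem_vanishingOn (hσ' : σ'.IsSmooth) {ϖ : F} (hϖ : IsUniformizingElement ϖ)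
    {s : ℂ} (hs : ∀ w : W, σ' ⟨diagGL (Fin (n + 2)) (Function.update 1 0 (Units.mk0 ϖ hϖ.ne_zero)),
      diagGL_mem_standardParabolicGL _ _⟩ w = s • w)
    (f : Representation.SmoothInd (standardParabolicGL F (lastBlockLabel (n + 2))) σ')
    (hf : f ∈ vanishingOn (standardParabolicGL F (lastBlockLabel (n + 2))) σ'
      (cellLT (K := F) (lastBlockLabel (n + 2)) Fin.revPerm)) :
    Representation.Coinvariants.mk (Representation.restrictUnipotentGL F (lastBlockLabel (n + 2)) (Representation.smoothIndRep (standardParabolicGL F (lastBlockLabel (n + 2))) σ')) (Representation.smoothIndRep (standardParabolicGL F (lastBlockLabel (n + 2))) σ' (diagGL (Fin (n + 2)) (Function.update 1 (Fin.last (n + 1)) (Units.mk0 ϖ hϖ.ne_zero))) f) =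
      ((GaloisRepresentations.IsNonarchimedeanLocalField.residueFieldCard F : ℂ) * s) • Representation.Coinvariants.mk (Representation.restrictUnipotentGL F (lastBlockLabel (n + 2)) (Representation.smoothIndRep (standardParabolicGL F (lastBlockLabel (n + 2))) σ')) f := by
  classical
  haveI : T2Space F := (GaloisRepresentations.IsNonarchimedeanLocalField.isLocalField F).toT2Space
  have hc : Monotone (lastBlockLabel (n + 2)) := monotone_lastBlockLabel (n + 2)
  -- Step 1: a congruence box `K' = N' ∩ K_{ϖ^m}`, `m ≥ 1`, fixing `f`
  obtain ⟨m, hm1, hmstab⟩ := exists_congruenceGL_pow_subset (n := n + 2) hϖ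
    ((Representation.isSmooth_smoothInd (standardParabolicGL F (lastBlockLabel (n + 2))) σ' f).mem_nhds
      (Subgroup.one_mem _))
  have hγ0 : valuation F ϖ ^ m ≠ 0 := pow_ne_zero _ ((Valuation.ne_zero_iff _).mpr hϖ.ne_zero)
  set K' : Subgroup ↥(oppositeCellRadical (K := F) (lastBlockLabel (n + 2))) :=
    (congruenceGL (n + 2) (valuation F ϖ ^ m)).comap (oppositeCellRadical (K := F) (lastBlockLabel (n + 2))).subtype
    with hK'_def
  have hK'o : IsOpen (K' : Set ↥(oppositeCellRadical (K := F) (lastBlockLabel (n + 2)))) := isOpen_comap_congruenceGL hγ0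
  have hK'c : IsCompact (K' : Set ↥(oppositeCellRadical (K := F) (lastBlockLabel (n + 2)))) := isCompact_comap_congruenceGL _
  have hK'stab : ∀ k ∈ K', ∀ x : GL (Fin (n + 2)) F, f.toFun (x * (k : GL (Fin (n + 2)) F)) = f.toFun x := fun k hk x =>
    toFun_w₀_mul_mul_of_mem_stabilizer (hmstab hk) x
  -- Step 2: the decomposition of `f` and the transversal
  obtain ⟨R, hR⟩ := exists_eq_sum_cellSection σ' hc hσ' K' hK'o hK'c f hf hK'stab
  obtain ⟨Rκ, hcard, hRU, hKs, hRκ⟩ := exists_transversal_conj_box (F := F) (n := n) hϖ hm1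
  -- `N'` is abelian, so the conjugates of `K'` by elements of `N'` are `K'`
  have hconjK : ∀ r : ↥(oppositeCellRadical (K := F) (lastBlockLabel (n + 2))),
      conjSubgroup (oppositeCellRadical_le_reversedParabolic (lastBlockLabel (n + 2)) r.2) K' = K' := by
    intro r
    ext x
    rw [mem_conjSubgroup_iff]
    have : (radicalConj (oppositeCellRadical_le_reversedParabolic (lastBlockLabel (n + 2)) r.2)).symm x = x :=
      Subtype.ext (by
        rw [coe_radicalConj_symm, mul_assoc, mul_comm_of_mem_oppositeCellRadical x.2 r.2, ← mul_assoc,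
          inv_mul_cancel, one_mul])
    rw [this]
  have hR' : f = ∑ r ∈ R, Representation.smoothIndRep (standardParabolicGL F (lastBlockLabel (n + 2))) σ' ((r : GL (Fin (n + 2)) F))⁻¹
      (cellSection σ' hc hσ' K' hK'o hK'c (f.toFun (permGL Fin.revPerm * (r : GL (Fin (n + 2)) F)))) := by
    refine hR.trans (Finset.sum_congr rfl fun r _ => ?_)
    rw [cellSection_congr hc hσ' (hconjK r) (isOpen_conjSubgroup _ hK'o) (isCompact_conjSubgroup _ hK'c) hK'o hK'c]
  -- Step 3: sum the classes
  have e7 : Representation.Coinvariants.mk (Representation.restrictUnipotentGL F (lastBlockLabel (n + 2)) (Representation.smoothIndRep (standardParabolicGL F (lastBlockLabel (n + 2))) σ')) (Representation.smoothIndRep (standardParabolicGL F (lastBlockLabel (n + 2))) σ' (diagGL (Fin (n + 2)) (Function.update 1 (Fin.last (n + 1)) (Units.mk0 ϖ hϖ.ne_zero))) f) =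
      ∑ r ∈ R, Representation.Coinvariants.mk (Representation.restrictUnipotentGL F (lastBlockLabel (n + 2)) (Representation.smoothIndRep (standardParabolicGL F (lastBlockLabel (n + 2))) σ')) (Representation.smoothIndRep (standardParabolicGL F (lastBlockLabel (n + 2))) σ' (diagGL (Fin (n + 2)) (Function.update 1 (Fin.last (n + 1)) (Units.mk0 ϖ hϖ.ne_zero)))
        (Representation.smoothIndRep (standardParabolicGL F (lastBlockLabel (n + 2))) σ' ((r : GL (Fin (n + 2)) F))⁻¹ (cellSection σ' hc hσ' K' hK'o hK'c (f.toFun (permGL Fin.revPerm * (r : GL (Fin (n + 2)) F)))))) := by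
    conv_lhs => rw [hR']
    rw [map_sum _ _ R]
    exact map_sum _ _ R
  have e8 : Representation.Coinvariants.mk (Representation.restrictUnipotentGL F (lastBlockLabel (n + 2)) (Representation.smoothIndRep (standardParabolicGL F (lastBlockLabel (n + 2))) σ')) f = ∑ r ∈ R, Representation.Coinvariants.mk (Representation.restrictUnipotentGL F (lastBlockLabel (n + 2)) (Representation.smoothIndRep (standardParabolicGL F (lastBlockLabel (n + 2))) σ')) (Representation.smoothIndRep (standardParabolicGL F (lastBlockLabel (n + 2))) σ' ((r : GL (Fin (n + 2)) F))⁻¹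
      (cellSection σ' hc hσ' K' hK'o hK'c (f.toFun (permGL Fin.revPerm * (r : GL (Fin (n + 2)) F))))) := by
    conv_lhs => rw [hR']
    exact map_sum _ _ R
  rw [e7, e8, Finset.smul_sum, ← hcard]
  have haP : permGL Fin.revPerm * diagGL (Fin (n + 2)) (Function.update 1 (Fin.last (n + 1)) (Units.mk0 ϖ hϖ.ne_zero)) *
      (permGL Fin.revPerm)⁻¹ ∈ standardParabolicGL F (lastBlockLabel (n + 2)) := by
    rw [permGL_rev_mul_diag_mul_inv]; exact diagGL_mem_standardParabolicGL _ _
  have haconj : (⟨permGL Fin.revPerm * diagGL (Fin (n + 2)) (Function.update 1 (Fin.last (n + 1)) (Units.mk0 ϖ hϖ.ne_zero)) *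
      (permGL Fin.revPerm)⁻¹, haP⟩ : ↥(standardParabolicGL F (lastBlockLabel (n + 2)))) =
      ⟨diagGL (Fin (n + 2)) (Function.update 1 0 (Units.mk0 ϖ hϖ.ne_zero)), diagGL_mem_standardParabolicGL _ _⟩ :=
    Subtype.ext (permGL_rev_mul_diag_mul_inv _)
  refine Finset.sum_congr rfl fun r _ => ?_
  refine mk_smoothIndRep_cellSection_transversal σ' hσ' _ haP K' hK'o hK'c Rκ _
    (fun ρ hρ => diag_conj_mul_mem_unipotentRadicalGL _ r.2 ρ.2 (hRU ρ hρ).2) hKs hRκ ?_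
  rw [haconj]
  exact hs _

end Literature.NumberTheory.Automorphic.Zelevinsky1980

end
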